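import Summits.AnomalousDissipation.AnomalousDissipation.Theses.TaylorCertificates
import Summits.AnomalousDissipation.AnomalousDissipation.Cruxes.KolmogorovFloor.Disproof

/-!
# Sketch — crux-ideate stmt-AnomalousDissipation-15122 (`TaylorCertificates.KolmogorovFloor`, restored copy of 14030),
# gen 1 round 1 ideator 1: the POLYNOMIAL-RATE CLOSURE cut of the negative line

Companion of `idea-polynomial-rate-closure.md` and `VERDICT-g1-r1-1.md`.

* §0 BUILD AUDIT (finding): the landed kill kernel `Theorems/KolmogorovFloor/Negative/CheapStatesKill.lean`
  (`kolmogorovFloor_false_of_CheapSteadyEulerStates`, landed 06:38Z, one minute before the rev-13 drop of the decl)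
  and `Negative/QuietPointKill.lean` are reported `unbuilt/stale` by the farm at 08:5xZ (probe imports rc 75), while
  `CheapBaseKill`, `FarField`, `WeightsVanish` and `Cruxes/KolmogorovFloor/Disproof.lean` build (rc 0). So this file
  imports the standing `Disproof.lean`, uses its verbatim MIRROR `CheapSteadyEulerStates'` of the interface, and takes
  the kernel as an explicit hypothesis `Kernel` (= the landed theorem, to be discharged by the import once rebuilt).
* §1 `CheapSlackAt f η a` — the landed per-state CHEAP predicate with slack in the two `f`-dependent clauses
  (work `≤ ½ η^{2/5}`, defect `≤ (η/2)·M`); resources (enstrophy, energy, slope) verbatim.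
* §2 `PolyDegreeCheap` — the FRAME-FREE, ν-FREE, DEGREE-GRADED Euler statement: trigonometric-polynomial forces of
  degree `≤ L` are cheaply almost steady-Euler forces down to a threshold POLYNOMIAL in `L·(1 + ‖ĝ‖_{ℓ¹})`.
* §3 `TailReduction : PolyDegreeCheap → CheapSteadyEulerStates'` (support, provable now: smooth Fourier tails) and the
  kill by name `not_kolmogorovFloor_of_polyDegreeCheap` (PROVED logic over the landed kernel).
* §4 `TailPerturbation` — the one-line mechanism of §3 typed separately (cheap for `g` + small `f − g` ⇒ cheap for `f`).
-/

noncomputable section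

set_option linter.dupNamespace false

open MeasureTheory UnitAddTorus
open scoped InnerProductSpace ENNReal BigOperators

namespace Summit.AnomalousDissipation.AnomalousDissipation.Cruxes.KolmogorovFloor.PolyRate

open Literature.Analysis.FunctionSpaces Literature.Analysis.FluidPDE
open Summit.AnomalousDissipation.AnomalousDissipation.Theses.TaylorCertificates
open Summit.AnomalousDissipation.AnomalousDissipation.Cruxes.KolmogorovFloor.Disproof

local notation "𝕋³" => UnitAddTorus (Fin 3)
local notation "E³" => EuclideanSpace ℝ (Fin 3)

/-! ## §0 The kernel (landed theorem, module unbuilt on the farm at filing time) as a named hypothesis -/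

/-- `Kernel` := the statement of the LANDED `Negative/CheapStatesKill.lean ::
kolmogorovFloor_false_of_CheapSteadyEulerStates`, over the Disproof's verbatim mirror of the interface. -/
def Kernel : Prop := CheapSteadyEulerStates' → ¬ KolmogorovFloor

/-! ## §1 The per-state CHEAP predicate with slack in the force-dependent clauses -/

/-- `a` is an `η`-cheap approximate steady Euler state for the force `f`, in the shape of the landed
`CheapSteadyEulerStates` body, with SLACK `1/2` in the two clauses that mention `f` (work, defect) and the three
resource clauses (enstrophy, energy, slope — properties of `a` alone) verbatim. -/
def CheapSlackAt (f : 𝕋³ → E³) (η : ℝ) (a : 𝕋³ → E³) : Prop :=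
  Torus.IsSmooth a ∧ Torus.IsDivFree a ∧ Torus.HasZeroMean a ∧
  (Torus.eGradNormSq a).toReal ≤ η ^ (-(11 / 10 : ℝ)) ∧ (∫ x, ‖a x‖ ^ 2) ≤ η ^ (-(11 / 10 : ℝ)) ∧
  (∀ N : ℕ, ∑ κ ∈ Torus.freqBall N, Real.sqrt (Torus.freqNormSq κ) * ‖mFourierCoeff (EuclideanSpace.complexify ∘ a) κ‖ ≤
    η ^ (-(3 / 5 : ℝ))) ∧
  |∫ x, ⟪a x, f x⟫_ℝ| ≤ (1 / 2) * η ^ (2 / 5 : ℝ) ∧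
  ∀ (N : ℕ) (W : 𝕋³ → E³) (M : ℝ), Torus.IsSmooth W → Torus.IsDivFree W → Torus.HasZeroMean W →
    (∀ κ, (N : ℝ) ^ 2 < Torus.freqNormSq κ → mFourierCoeff (EuclideanSpace.complexify ∘ W) κ = 0) →
    (∀ κ, Real.sqrt (Torus.freqNormSq κ) * ‖mFourierCoeff (EuclideanSpace.complexify ∘ W) κ‖ ≤ M) →
    |∫ x, ⟪Torus.convect a a x - f x, W x⟫_ℝ| ≤ (η / 2) * M

/-- The landed body (no slack), for reference: `CheapAt f η a`. -/
def CheapAt (f : 𝕋³ → E³) (η : ℝ) (a : 𝕋³ → E³) : Prop :=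
  Torus.IsSmooth a ∧ Torus.IsDivFree a ∧ Torus.HasZeroMean a ∧
  (Torus.eGradNormSq a).toReal ≤ η ^ (-(11 / 10 : ℝ)) ∧ (∫ x, ‖a x‖ ^ 2) ≤ η ^ (-(11 / 10 : ℝ)) ∧
  (∀ N : ℕ, ∑ κ ∈ Torus.freqBall N, Real.sqrt (Torus.freqNormSq κ) * ‖mFourierCoeff (EuclideanSpace.complexify ∘ a) κ‖ ≤
    η ^ (-(3 / 5 : ℝ))) ∧
  |∫ x, ⟪a x, f x⟫_ℝ| ≤ η ^ (2 / 5 : ℝ) ∧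
  ∀ (N : ℕ) (W : 𝕋³ → E³) (M : ℝ), Torus.IsSmooth W → Torus.IsDivFree W → Torus.HasZeroMean W →
    (∀ κ, (N : ℝ) ^ 2 < Torus.freqNormSq κ → mFourierCoeff (EuclideanSpace.complexify ∘ W) κ = 0) →
    (∀ κ, Real.sqrt (Torus.freqNormSq κ) * ‖mFourierCoeff (EuclideanSpace.complexify ∘ W) κ‖ ≤ M) →
    |∫ x, ⟪Torus.convect a a x - f x, W x⟫_ℝ| ≤ η * M

/-- `CheapSteadyEulerStates'` is literally "∀ f adm ∃ η₀ ∀ η ∈ (0,η₀) ∃ a, CheapAt f η a". -/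
theorem cheapSteadyEulerStates_iff :
    CheapSteadyEulerStates' ↔
      ∀ f : 𝕋³ → E³, Torus.IsSmooth f → Torus.IsDivFree f → Torus.HasZeroMean f →
        ∃ η₀ : ℝ, 0 < η₀ ∧ ∀ η : ℝ, 0 < η → η < η₀ → ∃ a : 𝕋³ → E³, CheapAt f η a :=
  Iff.rfl

/-- Slack is slack: a slack-cheap state is cheap (`η > 0`, `M ≥ 0` forced by the hypotheses when used; here we only
need `0 ≤ η^{2/5}` and `(η/2)·M ≤ η·M` for `M ≥ 0`, and for `M < 0` the defect hypothesis is vacuous-false anyway,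
so we state the implication under `0 < η` and prove the `M`-clause by cases). -/
theorem cheapAt_of_slack {f : 𝕋³ → E³} {η : ℝ} (hη : 0 < η) {a : 𝕋³ → E³} (h : CheapSlackAt f η a) :
    CheapAt f η a := by
  obtain ⟨h1, h2, h3, h4, h5, h6, h7, h8⟩ := h
  refine ⟨h1, h2, h3, h4, h5, h6, ?_, ?_⟩
  · have : (0 : ℝ) ≤ η ^ (2 / 5 : ℝ) := Real.rpow_nonneg hη.le _
    linarith
  · intro N W M hW hWd hWz hband hM
    have hWM := h8 N W M hW hWd hWz hband hM
    have hM0 : 0 ≤ M := by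
      have := hM 0
      have h0 : Real.sqrt (Torus.freqNormSq (0 : Fin 3 → ℤ)) *
          ‖mFourierCoeff (EuclideanSpace.complexify ∘ W) 0‖ ≥ 0 := by positivity
      linarith
    have : (η / 2) * M ≤ η * M := by nlinarith
    linarith

/-! ## §2 The degree-graded, frame-free Euler statement with a POLYNOMIAL rate -/

/-- The `ℓ¹` mass of the Fourier coefficients of a trigonometric polynomial `g` of degree `≤ L`. -/
def coeffMass (L : ℕ) (g : 𝕋³ → E³) : ℝ :=
  ∑ κ ∈ Torus.freqBall L, ‖mFourierCoeff (EuclideanSpace.complexify ∘ g) κ‖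

/-- **PolyDegreeCheap** (the Euler-side SPEC of the negative line, frame-free and ν-free): there are an exponent
`p` and a constant `A > 0` such that every solenoidal mean-zero trigonometric-polynomial force `g` of degree `≤ L`
admits slack-cheap states at EVERY level `η ≤ (A·L·(1 + coeffMass L g))^{-p}`. (Met on paper by the lacunary-frame
dressed laminar ray — LACUNARY-FRAME-r2-5 / cheap-steady-euler-closure E2–E3, constants `poly(L)`; the CLOSURE LAW
of the card says the polynomial rate is exactly what the tail dump over all `C^∞` forces needs.) -/
def PolyDegreeCheap : Prop :=
  ∃ (p : ℕ) (A : ℝ), 0 < A ∧ ∀ (L : ℕ) (g : 𝕋³ → E³), 1 ≤ L → Torus.IsSmooth g → Torus.IsDivFree g →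
    Torus.HasZeroMean g → Torus.fourierTruncate L g = g →
    ∀ η : ℝ, 0 < η → η ≤ (A * (L : ℝ) * (1 + coeffMass L g)) ^ (-(p : ℝ)) →
      ∃ a : 𝕋³ → E³, CheapSlackAt g η a

/-! ## §3 Tail reduction and the kill by name -/

/-- **TailReduction** (support, provable now, M): `PolyDegreeCheap → CheapSteadyEulerStates`. Paper proof: given a
smooth admissible `f` and `η`, put `F := Σ_κ ‖f̂(κ)‖ < ∞`, `L := ⌊η^{-1/p}/(A(1+F))⌋`; `g := fourierTruncate L f`
is admissible of degree `≤ L` with `coeffMass L g ≤ F`, so the threshold at `L` is `≥ η` and a slack-cheap `a` for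
`g` exists; smoothness gives `Σ_{|κ|>L} ‖f̂(κ)‖/|κ| ≤ C_{2p}(f) L^{-2p} ≤ η/2` and `‖f − g‖₂ ≤ ¼ η^{19/20}` for
`η < η₀(f)`, and `TailPerturbation` (§4) upgrades `a` to a cheap state for `f` at level `η`. -/
def TailReduction : Prop := PolyDegreeCheap → CheapSteadyEulerStates'

/-- **The crux dies by name from the degree-graded Euler statement** (logic over the landed kernel). -/
theorem not_kolmogorovFloor_of_polyDegreeCheap (hK : Kernel) (hT : TailReduction) (hP : PolyDegreeCheap) :
    ¬ KolmogorovFloor :=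
  hK (hT hP)

/-! ## §4 The tail-perturbation mechanism, typed -/

/-- **TailPerturbation** (FIRST LEMMA of the card; provable now, S–M): cheapness is stable under force perturbations
that are small in the beat-dual norm and in `L²`. If `a` is slack-cheap for `g` at level `η ∈ (0,1)`, and
`Σ_κ ‖(f−g)^(κ)‖/√|κ|² ≤ η/2` (so `|(f − g, W)| ≤ (η/2)·M` for every `W` with `√|κ|²‖Ŵ(κ)‖ ≤ M`), and
`(∫‖f−g‖²)^{1/2} · (∫‖a‖²)^{1/2} ≤ ½ η^{2/5}` (Cauchy–Schwarz budget for the work), then `a` is cheap for `f` at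
level `η` in the landed sense. -/
def TailPerturbation : Prop :=
  ∀ (f g : 𝕋³ → E³) (η : ℝ) (a : 𝕋³ → E³), Torus.IsSmooth f → Torus.IsSmooth g → 0 < η → η < 1 →
    CheapSlackAt g η a →
    (∑' κ : Fin 3 → ℤ, ‖mFourierCoeff (EuclideanSpace.complexify ∘ fun x => f x - g x) κ‖ / Real.sqrt (Torus.freqNormSq κ)
        ≤ η / 2) →
    Real.sqrt (∫ x, ‖f x - g x‖ ^ 2) * Real.sqrt (∫ x, ‖a x‖ ^ 2) ≤ (1 / 2) * η ^ (2 / 5 : ℝ) →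
    CheapAt f η a

end Summit.AnomalousDissipation.AnomalousDissipation.Cruxes.KolmogorovFloor.PolyRate
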